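import Summits.QuantumFields.YangMills.Theorems.BalabanLadderNTStrongCouplingInfluence
import Summits.Ventures.YMGap.Thresholds.StrongCouplingAllGroupsSharp
import Summits.Ventures.YMGap.Thresholds.QuarterModulusOneThird
import HarnessLib

/-!
# Crux `IR` (stmt-QuantumFields-19354), lane B «strong coupling AFTER BLOCKING»: the general-volume two-exterior influence engine from
# ANY single-link Dobrushin (Kantorovich–Rubinstein) contraction — the SHARP every-group door and the `SU(2)` quarter-modulus door

Helper module for item `stmt-QuantumFields-19354` (`--supports`; it closes nothing), lane `ym-19354-onsetsc-p2` (g5).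

WHY.  The g3 theorem «strong coupling after blocking at every mesh» (`blockedActivityClassW_strongCoupling_mesh`,
`Theorems/IR/BlockedActivityWStrongCouplingMesh`) runs on the NT lane's general-volume Dobrushin engine
`NT.StrongCoupling.abs_kerInt_sub_le_of_agree_ball`, whose window `216·N·|β| ≤ 1` (`SU(2)`: tree `|β| ≤ 1/432`, Wilson `β_W ≤ 1/216`) comes
from the CRUDE every-group total-variation coefficient `6N|β|` per plaquette neighbour.  The tree holds two much better single-link doors that
the lane had not used:
* the SHARP every-group total-variation coefficient `C_ρ |β|` (two distinct links lie on at most one plaquette;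
  `StrongCouplingAllGroupsSharp.isKRContraction_ymSpecification_sharp`, row sums `18 C_ρ |β|` in `d = 4`);
* for `SU(2)` the Kantorovich–Rubinstein (Frobenius-weight) one-link modulus with the floor constant `K₂ = 1/4`, PROVED for every Wilson
  `β_W ≤ 1/3` (`QuarterModulusOneThird.oneLinkKRModulusSU2_of_le_oneThird`), whose Dobrushin row sum is `9 β_W / 2` (`< 1` iff `β_W < 2/9`).
This file packages Georgii's general-volume comparison theorem (tree `DobrushinMetric.abs_kernel_sub_le_of_superSolution_of_ne`, Thm. 8.20)
once for an ARBITRARY single-link contraction `IsKRContraction (ymSpecification ρ β) r linkPlaqNbr C` with row sums `≤ α ≤ q < 1` and a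
bounded weight `r ≤ R` (profile super-solutions `q^{ℓ}` exactly as in the NT engine), and instantiates it at the two doors:

* `abs_kerInt_sub_le_of_profile_of_isKRContraction` — for EVERY finite `Λ`, every two exteriors `ω, η`, every `1`-Lipschitz profile `ℓ`
  vanishing where `ω ≠ η` off `Λ`, and every bounded measurable `f` depending on `Δ` with coordinatewise `r`-Lipschitz bounds `δ`:
  `|∫ f dγ_Λ(·|ω) − ∫ f dγ_Λ(·|η)| ≤ R · Σ_{z ∈ Δ} q^{ℓ z} δ_z`;  ball form `abs_kerInt_sub_le_of_agree_ball_of_isKRContraction`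
  (`ω = η` on the exterior links within sup-distance `m` of a site `y`, `f` reads links within `ρ₀` of `y` ⇒ `≤ R · q^{m+1−ρ₀} · Σ_{z∈Δ} δ_z`).
* EVERY COMPACT `G` (sharp door): `abs_kerInt_sub_le_of_agree_ball_sharp` — for a lattice representation `r` (`N = r.N`) and
  `18·N·|β| ≤ q`, `0 < q < 1`: `|∫ f dγ_Λ(·|ω) − ∫ f dγ_Λ(·|η)| ≤ 2M · #Δ · q^{m+1−ρ₀}` (the NT engine's statement with `216 ↦ 18/q`).
* `SU(2)` (quarter-modulus door): `su2_isKRContraction_quarter` — for `0 ≤ β_W ≤ 1/3` the Wilson specification at tree coupling `β_W/2`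
  (`ymSpecification (fundamentalRep (Fin 2)) (2·(β_W/4))`) is a Kantorovich contraction for the Frobenius weight with coefficients
  `(β_W/4)·n(x,y)` (`n` = the staple influence count `linkInfluence`) and row sums `≤ 9β_W/2` (`su2_row_sum_quarter`); `su2_abs_kerInt_sub_le_of_agree_ball_quarter` — the ball form for
  Frobenius-Lipschitz cylinders at `9β_W/2 ≤ q < 1`, constant `2√2`.

HONEST FRAMING: high-temperature (Dobrushin-uniqueness) LATTICE statements for arbitrary finite volumes and boundary data; the engine of the
lane's strong-side rows (`Theorems/IR/BlockedActivityWStrongCouplingKR`), nothing about weak coupling, the onset, a gap or Clay.  No `sorry`;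
axioms ⊆ {propext, Classical.choice, Quot.sound}; no instances, no notation.
Refs: Dobrushin 1970 Thm. 3; Föllmer LNM 1362 (1988) Ch. I (2.10)–(2.20); Georgii 2011 Thm. 8.20, Rem. 8.26; Simon CMP 68 (1979);
Shen–Zhu–Zhu CMP 400 (2023) (Dobrushin route, remark after Rem. 1.3).
-/

set_option autoImplicit false

noncomputable section

open MeasureTheory
open Literature.MathematicalPhysics.QuantumFieldTheory hiding ZdEdge Site
open Literature.MathematicalPhysics.QuantumLattice
open Literature.Probability.LatticeModels Literature.Probability.LatticeModels.DobrushinMetric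
open Summit.QuantumFields.YangMills.Cruxes.NT.StrongCoupling (sum_mul_pow_profile_le ballProfile_lipschitz)

namespace Summit.QuantumFields.YangMills.Cruxes.IR.BlockedActivity.KRInfluence

/-! ## §1 The engine: general-volume two-exterior influence from any single-link Kantorovich contraction -/

section General

variable {G : Type} [Group G] [TopologicalSpace G] [IsTopologicalGroup G] [CompactSpace G] [MeasurableSpace G] [BorelSpace G]
  [T2Space G] [SecondCountableTopology G] {N : ℕ} {ρ : G →* Matrix (Fin N) (Fin N) ℂ}

/-- **General-volume boundary influence from a single-link Kantorovich–Rubinstein contraction, profile form.**  Let the Wilson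
specification `γ = ymSpecification ρ β` satisfy Dobrushin's condition in the Kantorovich form for a weight `0 ≤ r ≤ R` with nonnegative
coefficients `C` over plaquette neighbours and row sums `≤ α ≤ q`, `0 < q < 1`.  Then for EVERY finite link set `Λ`, every two exteriors
`ω, η`, every profile `ℓ : links → ℕ` that is `1`-Lipschitz along plaquette neighbours and VANISHES at every link off `Λ` where `ω ≠ η`, and
every bounded measurable `f` depending on the finite link set `Δ` with coordinatewise `r`-Lipschitz bounds `δ`:
`|∫ f dγ_Λ(·|ω) − ∫ f dγ_Λ(·|η)| ≤ R · Σ_{z ∈ Δ} q^{ℓ z} · δ z` (Georgii 2011 Thm. 8.20 with the super-solution `q^{ℓ}`). -/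
theorem abs_kerInt_sub_le_of_profile_of_isKRContraction (hρ : Continuous ρ) {β : ℝ} {r : G → G → ℝ} {R : ℝ}
    (hr0 : ∀ a b, 0 ≤ r a b) (hrR : ∀ a b, r a b ≤ R) (hR : 0 ≤ R) {C : ZdEdge 4 → ZdEdge 4 → ℝ}
    (hKR : IsKRContraction (ymSpecification (d := 4) ρ β) r linkPlaqNbr C) {α q : ℝ} (hq0 : 0 < q) (hq1 : q < 1) (hαq : α ≤ q)
    (hrow : ∀ x, ∑ z ∈ linkPlaqNbr x, C x z ≤ α) (Λ : Finset (ZdEdge 4)) (ω η : LGConfig 4 G) (ℓ : ZdEdge 4 → ℕ)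
    (hℓ : ∀ x, ∀ z ∈ linkPlaqNbr x, ℓ x ≤ ℓ z + 1) (hℓ0 : ∀ z, z ∉ Λ → ω z ≠ η z → ℓ z = 0) {f : LGConfig 4 G → ℝ}
    (hfm : Measurable f) {Δ : Finset (ZdEdge 4)} (hdep : DependsOn f (↑Δ : Set (ZdEdge 4))) {M : ℝ} (hM : ∀ U, |f U| ≤ M)
    {δ : ZdEdge 4 → ℝ} (hδ : IsLipBound r f δ) :
    |(∫ U, f U ∂(ymSpecification (d := 4) ρ β Λ ω)) - ∫ U, f U ∂(ymSpecification (d := 4) ρ β Λ η)| ≤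
      R * ∑ z ∈ Δ, q ^ ℓ z * δ z := by
  classical
  have hγ := isSpecification_ymSpecification_of_t2Space (d := 4) ρ hρ β
  have hα0 : 0 ≤ α := le_trans (Finset.sum_nonneg fun z _ => hKR.nonneg _ z) (hrow default)
  -- the super-solution `q^{ℓ}`
  have hsol := fun x (_ : x ∈ Λ) => sum_mul_pow_profile_le (nbr := linkPlaqNbr) (C := C) hKR.nonneg hq0 hq1.le hαq hrow hℓ x
  have hrowW : ∀ x ∈ Λ, ∑ z ∈ linkPlaqNbr x, (if z ∈ Λ then C x z else 0) ≤ α := fun x _ =>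
    (Finset.sum_le_sum fun z _ => by split_ifs <;> first | exact le_rfl | exact hKR.nonneg x z).trans (hrow x)
  exact abs_kernel_sub_le_of_superSolution_of_ne hγ hKR hr0 hrR hR Λ ω η (d := fun z => q ^ ℓ z) (fun z => by positivity)
    (fun z hz hne => by rw [hℓ0 z hz hne, pow_zero]) hsol hα0 (hαq.trans_lt hq1) hrowW hfm hdep hM hδ

/-- **Agreement form, ball profile.**  Under the hypotheses of `abs_kerInt_sub_le_of_profile_of_isKRContraction`: if `ω = η` on every link OFF
`Λ` whose base point is within sup-distance `m` of the site `y` (integer part) and `f` reads only links based within sup-distance `ρ₀` of `y`, then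
`|∫ f dγ_Λ(·|ω) − ∫ f dγ_Λ(·|η)| ≤ R · q^{m+1−ρ₀} · Σ_{z ∈ Δ} δ z` — for ANY finite `Λ` (no shape condition). -/
theorem abs_kerInt_sub_le_of_agree_ball_of_isKRContraction (hρ : Continuous ρ) {β : ℝ} {r : G → G → ℝ} {R : ℝ}
    (hr0 : ∀ a b, 0 ≤ r a b) (hrR : ∀ a b, r a b ≤ R) (hR : 0 ≤ R) {C : ZdEdge 4 → ZdEdge 4 → ℝ}
    (hKR : IsKRContraction (ymSpecification (d := 4) ρ β) r linkPlaqNbr C) {α q : ℝ} (hq0 : 0 < q) (hq1 : q < 1) (hαq : α ≤ q)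
    (hrow : ∀ x, ∑ z ∈ linkPlaqNbr x, C x z ≤ α) (Λ : Finset (ZdEdge 4)) (ω η : LGConfig 4 G) (y : Fin 4 → ℤ) (m : ℕ)
    (hagree : ∀ z, z ∉ Λ → ⌊‖z.1 - y‖⌋₊ ≤ m → ω z = η z) {f : LGConfig 4 G → ℝ} (hfm : Measurable f)
    {Δ : Finset (ZdEdge 4)} (hdep : DependsOn f (↑Δ : Set (ZdEdge 4))) {M : ℝ} (hM : ∀ U, |f U| ≤ M)
    {δ : ZdEdge 4 → ℝ} (hδ : IsLipBound r f δ) {ρ₀ : ℕ} (hΔ : ∀ z ∈ Δ, ⌊‖z.1 - y‖⌋₊ ≤ ρ₀) :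
    |(∫ U, f U ∂(ymSpecification (d := 4) ρ β Λ ω)) - ∫ U, f U ∂(ymSpecification (d := 4) ρ β Λ η)| ≤
      R * q ^ (m + 1 - ρ₀) * ∑ z ∈ Δ, δ z := by
  have h := abs_kerInt_sub_le_of_profile_of_isKRContraction hρ hr0 hrR hR hKR hq0 hq1 hαq hrow Λ ω η
    (fun z => m + 1 - ⌊‖z.1 - y‖⌋₊) (fun x z hz => ballProfile_lipschitz y m x z hz)
    (fun z hz hne => by
      have : ¬ (⌊‖z.1 - y‖⌋₊ ≤ m) := fun hle => hne (hagree z hz hle)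
      omega) hfm hdep hM hδ
  refine h.trans ?_
  have hsum : ∑ z ∈ Δ, q ^ (m + 1 - ⌊‖z.1 - y‖⌋₊) * δ z ≤ ∑ z ∈ Δ, q ^ (m + 1 - ρ₀) * δ z :=
    Finset.sum_le_sum fun z hz => mul_le_mul_of_nonneg_right
      (pow_le_pow_of_le_one hq0.le hq1.le (by have := hΔ z hz; omega)) (hδ.nonneg z)
  rw [← Finset.mul_sum] at hsum
  calc R * ∑ z ∈ Δ, q ^ (m + 1 - ⌊‖z.1 - y‖⌋₊) * δ z ≤ R * (q ^ (m + 1 - ρ₀) * ∑ z ∈ Δ, δ z) :=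
        mul_le_mul_of_nonneg_left hsum hR
    _ = R * q ^ (m + 1 - ρ₀) * ∑ z ∈ Δ, δ z := by ring

end General

/-! ## §2 Every compact `G`: the SHARP total-variation door `18·N·|β| < 1` -/

section Sharp

variable (G : Type) [Group G] [TopologicalSpace G] [IsTopologicalGroup G] [CompactSpace G] [MeasurableSpace G] [BorelSpace G]
  (r : LatticeRep G)

/-- **Every compact `G`, SHARP door, ball form.**  For a lattice representation `r` (`N = r.N`) and `18·N·|β| ≤ q`, `0 < q < 1` (the sharp
total-variation Dobrushin matrix of `isKRContraction_ymSpecification_sharp` has row sums `≤ 18 N |β|`): if the exteriors `ω, η` agree on every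
link OFF `Λ` based within sup-distance `m` of the site `y` and `f` (measurable, `|f| ≤ M`, depending on `Δ`) reads only links based within
sup-distance `ρ₀` of `y`, then `|∫ f dγ_Λ(·|ω) − ∫ f dγ_Λ(·|η)| ≤ 2M · #Δ · q^{m+1−ρ₀}` — for ANY finite `Λ`.  (The NT engine's
`abs_kerInt_sub_le_of_agree_ball` is the case `q = 1/2` at `216 N |β| ≤ 1`; here `36 N |β| ≤ 1` suffices for `q = 1/2`.) -/
theorem abs_kerInt_sub_le_of_agree_ball_sharp {β q : ℝ} (hq0 : 0 < q) (hq1 : q < 1) (hβ : 18 * (r.N : ℝ) * |β| ≤ q)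
    (Λ : Finset (ZdEdge 4)) (ω η : LGConfig 4 G) (y : Fin 4 → ℤ) (m : ℕ)
    (hagree : ∀ z, z ∉ Λ → ⌊‖z.1 - y‖⌋₊ ≤ m → ω z = η z) {f : LGConfig 4 G → ℝ} (hfm : Measurable f)
    {Δ : Finset (ZdEdge 4)} (hdep : DependsOn f (↑Δ : Set (ZdEdge 4))) {M : ℝ} (hM : ∀ U, |f U| ≤ M) {ρ₀ : ℕ}
    (hΔ : ∀ z ∈ Δ, ⌊‖z.1 - y‖⌋₊ ≤ ρ₀) :
    |(∫ U, f U ∂(ymSpecification (d := 4) r.ρ β Λ ω)) - ∫ U, f U ∂(ymSpecification (d := 4) r.ρ β Λ η)| ≤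
      2 * M * Δ.card * q ^ (m + 1 - ρ₀) := by
  classical
  haveI := r.t2Space
  haveI := r.secondCountableTopology
  have hM0 : 0 ≤ M := (abs_nonneg _).trans (hM fun _ => 1)
  have hKR := Summit.Ventures.YMGap.StrongCouplingAllGroupsSharp.isKRContraction_ymSpecification_sharp (d := 4) r.ρ r.continuous
    (Nat.cast_nonneg r.N) (abs_plaquetteObs_le_holds r.ρ r.mem_unitary) β
  have hrow : ∀ x : ZdEdge 4, ∑ _z ∈ linkPlaqNbr x, (r.N : ℝ) * |β| ≤ 18 * (r.N : ℝ) * |β| := fun x => by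
    have h := Summit.Ventures.YMGap.StrongCouplingAllGroupsSharp.row_sum_le_sharp (d := 4) (β := β) (Nat.cast_nonneg r.N) x
    refine h.trans (le_of_eq ?_)
    norm_num
  have h := abs_kerInt_sub_le_of_agree_ball_of_isKRContraction r.continuous (r := fun _ _ : G => (1 : ℝ)) (R := 1)
    (fun _ _ => zero_le_one) (fun _ _ => le_rfl) zero_le_one hKR hq0 hq1 hβ hrow Λ ω η y m hagree hfm hdep hM
    (Summit.Ventures.YMGap.StrongCouplingAllGroups.isLipBound_one_of_abs_le hM hdep) hΔ
  refine h.trans (le_of_eq ?_)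
  rw [Finset.sum_ite_of_true (fun z hz => hz), Finset.sum_const, nsmul_eq_mul]
  ring

end Sharp

/-! ## §3 `SU(2)`: the quarter-modulus Kantorovich door `9β_W/2 < 1` -/

section SU2

open Literature.MathematicalPhysics.QuantumFieldTheory.Balaban1983to89.StrongCouplingDobrushinWindow (OneLinkKRModulus)
open Summit.Ventures.YMGap.QuarterModulusOneThird (oneLinkKRModulusSU2_of_le_oneThird)

/-- **`SU(2)`: the quarter-modulus Kantorovich contraction.**  For `0 ≤ β_W ≤ 1/3` the `SU(2)` Wilson specification on `ℤ⁴` at tree coupling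
`2·(β_W/4) = β_W/2` satisfies Dobrushin's condition in the Kantorovich form for the Frobenius weight with coefficients `(β_W/4) · n(x, y)` (the staple influence count `linkInfluence`)
(the one-link modulus `OneLinkKRModulusSU2 β_W (1/4)` = `OneLinkKRModulus 2 (3β_W/2) 1`, PROVED in `QuarterModulusOneThird`, read through the
staple-field dictionary exactly as in `StrongCouplingDobrushinWindow.dlrMassGap_of_oneLinkKRModulus`). -/
theorem su2_isKRContraction_quarter {βW : ℝ} (h0 : 0 ≤ βW) (h13 : βW ≤ 1 / 3) :
    IsKRContraction (ymSpecification (d := 4) (fundamentalRep (Fin 2)) ((2 : ℕ) * (βW / 4))) suFrobDist linkPlaqNbr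
      (fun x y => βW / 4 * (linkInfluence x y : ℝ)) := by
  classical
  have hmod : OneLinkKRModulus 2 (3 * βW / 2) (4 * (1 / 4)) := oneLinkKRModulusSU2_of_le_oneThird h13
  have hR : |βW / 4| * (2 * (((4 : ℕ) : ℝ) - 1)) ≤ 3 * βW / 2 := by
    rw [abs_of_nonneg (by linarith)]; push_cast; linarith
  refine isKRContraction_ymSpecification _ (continuous_fundamentalRep (Fin 2)) _ (fun x y => by positivity) ?_
  intro x y _ ω η hωη φ L hφm hφb hL hφL
  rw [siteLaw_ymSpecification_thooft (βW / 4) x ω, siteLaw_ymSpecification_thooft (βW / 4) x η]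
  have hBω : matrixOpNorm (stapleField (βW / 4) x ω) ≤ 3 * βW / 2 :=
    (matrixOpNorm_stapleField_le (by norm_num) (by norm_num) (βW / 4) x ω).trans hR
  have hBη : matrixOpNorm (stapleField (βW / 4) x η) ≤ 3 * βW / 2 :=
    (matrixOpNorm_stapleField_le (by norm_num) (by norm_num) (βW / 4) x η).trans hR
  have key := hmod _ _ hBω hBη φ L hφm hφb hL hφL
  refine key.trans ?_
  have hdiff := frobNorm_stapleField_sub_le (βW / 4) x y hωη
  calc 4 * (1 / 4) * L * frobNorm (stapleField (βW / 4) x ω - stapleField (βW / 4) x η)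
      ≤ 4 * (1 / 4) * L * (|βW / 4| * linkInfluence x y * suFrobDist (ω y) (η y)) :=
        mul_le_mul_of_nonneg_left hdiff (by positivity)
    _ = βW / 4 * (linkInfluence x y : ℝ) * L * suFrobDist (ω y) (η y) := by
        rw [abs_of_nonneg (by linarith)]; ring

/-- Row sums of the quarter-modulus coefficients: `Σ_{y} (β_W/4) n(x,y) ≤ (β_W/4) · 18 = 9β_W/2`. -/
theorem su2_row_sum_quarter {βW : ℝ} (h0 : 0 ≤ βW) (x : ZdEdge 4) :
    ∑ y ∈ linkPlaqNbr x, βW / 4 * (linkInfluence x y : ℝ) ≤ 9 * βW / 2 := by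
  classical
  rw [← Finset.mul_sum]
  have hsum : ∑ y ∈ linkPlaqNbr x, (linkInfluence x y : ℝ) ≤ 18 := by
    have h := sum_linkInfluence_le (d := 4) x
    calc ∑ y ∈ linkPlaqNbr x, (linkInfluence x y : ℝ) = ((∑ y ∈ linkPlaqNbr x, linkInfluence x y : ℕ) : ℝ) := by push_cast; rfl
      _ ≤ ((6 * (4 - 1) : ℕ) : ℝ) := by exact_mod_cast h
      _ = 18 := by norm_num
  calc βW / 4 * ∑ y ∈ linkPlaqNbr x, (linkInfluence x y : ℝ) ≤ βW / 4 * 18 := mul_le_mul_of_nonneg_left hsum (by linarith)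
    _ = 9 * βW / 2 := by ring

/-- **`SU(2)`, quarter-modulus door, ball form.**  For `0 ≤ β_W ≤ 1/3`, `9β_W/2 ≤ q`, `0 < q < 1`: if the exteriors `ω, η` agree on every
link OFF `Λ` based within sup-distance `m` of the site `y` and `f` (measurable, bounded, depending on `Δ`, with coordinatewise FROBENIUS-Lipschitz
bounds `δ`) reads only links based within sup-distance `ρ₀` of `y`, then
`|∫ f dγ_Λ(·|ω) − ∫ f dγ_Λ(·|η)| ≤ 2√2 · q^{m+1−ρ₀} · Σ_{z∈Δ} δ z` for the `SU(2)` Wilson kernels at tree coupling `β_W/2` — ANY finite `Λ`. -/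
theorem su2_abs_kerInt_sub_le_of_agree_ball_quarter {βW q : ℝ} (h0 : 0 ≤ βW) (h13 : βW ≤ 1 / 3) (hq0 : 0 < q) (hq1 : q < 1)
    (hβq : 9 * βW / 2 ≤ q) (Λ : Finset (ZdEdge 4)) (ω η : LGConfig 4 (Matrix.specialUnitaryGroup (Fin 2) ℂ)) (y : Fin 4 → ℤ)
    (m : ℕ) (hagree : ∀ z, z ∉ Λ → ⌊‖z.1 - y‖⌋₊ ≤ m → ω z = η z)
    {f : LGConfig 4 (Matrix.specialUnitaryGroup (Fin 2) ℂ) → ℝ} (hfm : Measurable f) {Δ : Finset (ZdEdge 4)}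
    (hdep : DependsOn f (↑Δ : Set (ZdEdge 4))) {M : ℝ} (hM : ∀ U, |f U| ≤ M) {δ : ZdEdge 4 → ℝ} (hδ : IsLipBound suFrobDist f δ)
    {ρ₀ : ℕ} (hΔ : ∀ z ∈ Δ, ⌊‖z.1 - y‖⌋₊ ≤ ρ₀) :
    |(∫ U, f U ∂(ymSpecification (d := 4) (fundamentalRep (Fin 2)) ((2 : ℕ) * (βW / 4)) Λ ω)) -
        ∫ U, f U ∂(ymSpecification (d := 4) (fundamentalRep (Fin 2)) ((2 : ℕ) * (βW / 4)) Λ η)| ≤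
      2 * Real.sqrt 2 * q ^ (m + 1 - ρ₀) * ∑ z ∈ Δ, δ z := by
  haveI : SecondCountableTopology (Matrix (Fin 2) (Fin 2) ℂ) := inferInstanceAs (SecondCountableTopology (Fin 2 → Fin 2 → ℂ))
  haveI : SecondCountableTopology (Matrix.specialUnitaryGroup (Fin 2) ℂ) := Topology.IsEmbedding.subtypeVal.secondCountableTopology
  have h := abs_kerInt_sub_le_of_agree_ball_of_isKRContraction (continuous_fundamentalRep (Fin 2)) (r := suFrobDist)
    (R := 2 * Real.sqrt 2) suFrobDist_nonneg (fun a b => by have := suFrobDist_le a b; exact_mod_cast this) (by positivity)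
    (su2_isKRContraction_quarter h0 h13) hq0 hq1 hβq (su2_row_sum_quarter h0) Λ ω η y m hagree hfm hdep hM hδ hΔ
  exact h

end SU2

end Summit.QuantumFields.YangMills.Cruxes.IR.BlockedActivity.KRInfluence

end
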